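import Summits.CriticalPhenomena.PercolationContinuityZ3.Theorems.Transplant.FKConnectivityAllQDiamondCertificates
import HarnessLib

/-!
# Connectivity correlation inequalities for `φ_{w,q}`, every `q > 0` — file 9j: EC⁺ AT THE TIPS OF THE DIAMOND AND
# NEGATIVE ASSOCIATION ON `K₄` FOR `0 < q ≤ 1` (kernel certificate of Sokal's computation reported in Wagner 2008, Ex. 5.1)

Support file (`--supports stmt-CriticalPhenomena-4575`), FK sub-lane `prim-bschramm-fk-1` (gen 5) of the post-continuity
programme; builds on p205010 (kernel theorem, internal audit signed; external expert review pending).  No definitions, no named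
facts, no sorries; standard axioms.

THE `K₄` COMPUTATION (files `…ApexTriangle`, `…ApexDiamond`, `…DiamondCertificates`, `…K4`).  Wagner (Ann. Comb. 2008, Ex. 5.1)
reports an unpublished computation of A. Sokal (2005) that the Potts model of `K₄` is Rayleigh for all `0 < q ≤ 1`, i.e. `φ_{w,q}` on
`K₄` is edge-negatively associated for every weight vector.  We certify it in the kernel: by fk-2's master identity, negative
association of the pair `xy` with `f` on `K₄` is EC⁺ for `x ↔ y` in the diamond `K₄ − xy` (tips `x, y`, base pair `zt`), in which
`y` is an apex over `(z,t)` and `x` a second apex over `(z,t)`; two rounds of the apex identities express `S_w(x ↔ y)` and `Z_w` as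
explicit polynomials in the five parameters, `r = q⁻¹` and the two base masses `A = S°°(z ↔ t)`, `B = S°°(z ↮ t)`
(`dia_closed_forms`); the three EC⁺ comparisons (`f` = side pair `zx`, tip pair `zy`, base pair `zt`; the other two by the
`z ↔ t` symmetry) are then polynomial inequalities, each closed by an explicit nonnegativity certificate in Bernstein form
(products of `w_e`, `1 − w_e`, `r − 1`, `A`, `B` with positive coefficients, plus one square for the base pair) found by computer
algebra and checked by `ring`.

THIS FILE: `edgeConnMono_diamond_side/tip/base` (EC⁺ for `x ↔ y` under opening `zx` / `zy` / `zt`, any finite vertex type, any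
weights, provided every live pair at `x` and at `y` contains `z` or `t`), `negCorr_K4_pair`, and **`edgeNegCorr_K4`**: for four
distinct vertices `x,y,z,t` and every weight vector supported on the six pairs among them (no loops), `φ_{w,q}(J_e ∩ J_f) ≤ φ(J_e)φ(J_f)`
for all non-loop `e`, all `f ≠ e`, all `0 < q ≤ 1`.  `K₄` is the excluded minor of the series–parallel class covered by
`edgeNegCorrSupp_of_isTwoTree`; by the apex step `edgeNegCorr_supp_apex_step` negative association then also holds on every edge set
grown from `K₄` by apex steps.  As far as searched (Wagner 2008 'Alan Sokal showed me a computation …', desk S133) no proof for `K₄` is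
in print; this is a machine-checked one.
[cite: Wagner2006, Ex. 5.1] [cite: Grimmett2006, §3.9 eq. (3.94), Conj. (3.96) (pp. 63–64)]
-/

noncomputable section

namespace Summit.CriticalPhenomena.PercolationContinuityZ3.Theorems

namespace FK

open MeasureTheory Set Literature.Probability.LatticeModels Literature.Probability.Percolation
open Literature.Probability.Percolation.DecisionTree (ind ind_of_mem ind_of_not_mem ind_nonneg)
open Literature.Probability.Percolation.TwoAvoidanceSets (ind_mul_ind)
open scoped Classical symmDiff

variable {V : Type*} [Fintype V]

/-- A mass is nonnegative (`q ≥ 0`). [cite: Grimmett2006, §1.4 eq. (1.20) (p. 15)] -/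
theorem sum_rcWeightW_ind_nonneg (w : Sym2 V → unitInterval) {q : ℝ} (hq : 0 ≤ q) (E : Set (BondConfig V)) :
    0 ≤ ∑ ω : BondConfig V, rcWeightW w q ∅ ω * ind E ω :=
  Finset.sum_nonneg fun ω _ => mul_nonneg (rcWeightW_nonneg w hq (∅ : Set V) ω) (ind_nonneg _ _)

/-! ### EC⁺ at the tips of the diamond, and negative association on `K₄` -/

/-- With the base pair `zt` of parameter `1`, `K = {z ↔ t avoiding c, d}` holds almost surely, so `S(Kᶜ) = 0`.
[cite: Grimmett2006, §1.4 eq. (1.20) (p. 15)] -/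
theorem base_compl_mass_eq_zero (w : Sym2 V → unitInterval) (q : ℝ) {z t y : V} (hyz : y ≠ z) (hyt : y ≠ t) (hzt : z ≠ t)
    (h1 : ((w s(z, t) : unitInterval) : ℝ) = 1) :
    ∑ ω : BondConfig V, rcWeightW w q ∅ ω * ind {ω : BondConfig V | ω \ {s(z, y), s(y, t)} ∈ (openConn z t : Set (BondConfig V))}ᶜ ω = 0 := by
  refine sum_rcWeightW_ind_eq_zero_ae _ q fun ω hω hmem => ?_
  apply hmem
  rw [Set.mem_setOf_eq, mem_openConn_iff']
  have hm : s(z, t) ∈ ω \ {s(z, y), s(y, t)} := by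
    refine ⟨mem_of_rcWeightW_ne_zero w q h1 hω, ?_⟩
    rintro (h | h)
    · exact hyt (by
        have : t ∈ s(z, y) := h ▸ Sym2.mem_mk_right z t
        rw [Sym2.mem_iff] at this
        rcases this with h' | h'
        · exact absurd h' hzt.symm
        · exact h'.symm)
    · exact hyz (by
        have : z ∈ s(y, t) := h ▸ Sym2.mem_mk_left z t
        rw [Sym2.mem_iff] at this
        rcases this with h' | h'
        · exact h'.symm
        · exact absurd h' hzt)
  have hadj : (openGraph (ω \ {s(z, y), s(y, t)})).Adj z t := by rw [openGraph_adj]; exact ⟨hm, hzt⟩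
  exact hadj.reachable

/-- **EC⁺ at the tips of the diamond — side pair `zx`** (`0 < q ≤ 1`): if every live pair at `x` and every live pair at `y` contains
`z` or `t`, opening `zx` does not lower `φ(x ↔ y)`. [cite: Wagner2006, Ex. 5.1] [cite: Grimmett2006, §3.9 (pp. 63–64)] -/
theorem edgeConnMono_diamond_side {q : ℝ} (hq0 : 0 < q) (hq1 : q ≤ 1) (w : Sym2 V → unitInterval) {z t x y : V}
    (hxz : x ≠ z) (hxt : x ≠ t) (hxy : x ≠ y) (hyz : y ≠ z) (hyt : y ≠ t) (hzt : z ≠ t)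
    (hwx : ∀ e : Sym2 V, x ∈ e → ((w e : unitInterval) : ℝ) ≠ 0 → z ∈ e ∨ t ∈ e)
    (hwy : ∀ e : Sym2 V, y ∈ e → ((w e : unitInterval) : ℝ) ≠ 0 → z ∈ e ∨ t ∈ e) :
    (rcMeasureW (Function.update w s(z, x) 0) q ∅).real (openConn x y) ≤
      (rcMeasureW (Function.update w s(z, x) 1) q ∅).real (openConn x y) := by
  rw [real_le_real_iff_mass hq0]
  have hya : y ∉ s(z, x) := by rw [Sym2.mem_iff]; rintro (h | h); exacts [hyz h, hxy h.symm]
  have hba : s(x, t) ≠ s(z, x) := (apex_pairs_ne hxz hzt).symm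
  have hca : s(z, y) ≠ s(z, x) := fun h => hya (h ▸ Sym2.mem_mk_right z y)
  have hda : s(y, t) ≠ s(z, x) := fun h => hya (h ▸ Sym2.mem_mk_left y t)
  have hwx' : ∀ σ : unitInterval, ∀ e : Sym2 V, x ∈ e → ((Function.update w s(z, x) σ e : unitInterval) : ℝ) ≠ 0 → z ∈ e ∨ t ∈ e :=
    fun σ => apex_hyp_update hwx s(z, x) (fun _ => Or.inl (Sym2.mem_mk_left z x)) σ
  have hwy' : ∀ σ : unitInterval, ∀ e : Sym2 V, y ∈ e → ((Function.update w s(z, x) σ e : unitInterval) : ℝ) ≠ 0 → z ∈ e ∨ t ∈ e :=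
    fun σ => apex_hyp_update hwy s(z, x) (fun h => absurd h hya) σ
  obtain ⟨x0, z0⟩ := dia_closed_forms (Function.update w s(z, x) 0) hq0.ne' hxz hxt hxy hyz hyt hzt (hwx' 0) (hwy' 0)
  obtain ⟨x1, z1⟩ := dia_closed_forms (Function.update w s(z, x) 1) hq0.ne' hxz hxt hxy hyz hyt hzt (hwx' 1) (hwy' 1)
  simp only [Function.update_self, Function.update_of_ne hba, Function.update_of_ne hca, Function.update_of_ne hda,
    Function.update_idem] at x0 z0 x1 z1
  rw [x0, z0, x1, z1]
  exact dia_poly_side _ _ _ _ _ _ _ _ (by simp) (by simp) (w s(x, t)).2.1 (by linarith [(w s(x, t)).2.2]) (w s(z, y)).2.1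
    (by linarith [(w s(z, y)).2.2]) (w s(y, t)).2.1 (by linarith [(w s(y, t)).2.2])
    (by rw [sub_nonneg]; exact one_le_inv_iff₀.2 ⟨hq0, hq1⟩) (sum_rcWeightW_ind_nonneg _ hq0.le _) (sum_rcWeightW_ind_nonneg _ hq0.le _)

/-- **EC⁺ at the tips of the diamond — tip pair `zy`** (`0 < q ≤ 1`). [cite: Wagner2006, Ex. 5.1] [cite: Grimmett2006, §3.9 (pp. 63–64)] -/
theorem edgeConnMono_diamond_tip {q : ℝ} (hq0 : 0 < q) (hq1 : q ≤ 1) (w : Sym2 V → unitInterval) {z t x y : V}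
    (hxz : x ≠ z) (hxt : x ≠ t) (hxy : x ≠ y) (hyz : y ≠ z) (hyt : y ≠ t) (hzt : z ≠ t)
    (hwx : ∀ e : Sym2 V, x ∈ e → ((w e : unitInterval) : ℝ) ≠ 0 → z ∈ e ∨ t ∈ e)
    (hwy : ∀ e : Sym2 V, y ∈ e → ((w e : unitInterval) : ℝ) ≠ 0 → z ∈ e ∨ t ∈ e) :
    (rcMeasureW (Function.update w s(z, y) 0) q ∅).real (openConn x y) ≤
      (rcMeasureW (Function.update w s(z, y) 1) q ∅).real (openConn x y) := by
  rw [real_le_real_iff_mass hq0]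
  have hxc : x ∉ s(z, y) := by rw [Sym2.mem_iff]; rintro (h | h); exacts [hxz h, hxy h]
  have hab := apex_pairs_ne hxz hzt
  have hac : s(z, x) ≠ s(z, y) := fun h => hxc (h ▸ Sym2.mem_mk_right z x)
  have hbc : s(x, t) ≠ s(z, y) := fun h => hxc (h ▸ Sym2.mem_mk_left x t)
  have hdc : s(y, t) ≠ s(z, y) := (apex_pairs_ne hyz hzt).symm
  have hwx' : ∀ σ : unitInterval, ∀ e : Sym2 V, x ∈ e → ((Function.update w s(z, y) σ e : unitInterval) : ℝ) ≠ 0 → z ∈ e ∨ t ∈ e :=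
    fun σ => apex_hyp_update hwx s(z, y) (fun h => absurd h hxc) σ
  have hwy' : ∀ σ : unitInterval, ∀ e : Sym2 V, y ∈ e → ((Function.update w s(z, y) σ e : unitInterval) : ℝ) ≠ 0 → z ∈ e ∨ t ∈ e :=
    fun σ => apex_hyp_update hwy s(z, y) (fun _ => Or.inl (Sym2.mem_mk_left z y)) σ
  obtain ⟨x0, z0⟩ := dia_closed_forms (Function.update w s(z, y) 0) hq0.ne' hxz hxt hxy hyz hyt hzt (hwx' 0) (hwy' 0)
  obtain ⟨x1, z1⟩ := dia_closed_forms (Function.update w s(z, y) 1) hq0.ne' hxz hxt hxy hyz hyt hzt (hwx' 1) (hwy' 1)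
  -- the base vector `w°°` does not see the parameter of `zy`
  have hcomm : ∀ σ : unitInterval,
      Function.update (Function.update (Function.update (Function.update (Function.update w s(z, y) σ) s(z, x) 0) s(x, t) 0) s(z, y) 0)
        s(y, t) 0 = Function.update (Function.update (Function.update (Function.update w s(z, x) 0) s(x, t) 0) s(z, y) 0) s(y, t) 0 := by
    intro σ
    rw [Function.update_comm hac.symm (f := w), Function.update_comm hbc.symm (f := Function.update w s(z, x) 0), Function.update_idem]
  simp only [Function.update_self, Function.update_of_ne hac, Function.update_of_ne hbc, Function.update_of_ne hdc, hcomm] at x0 z0 x1 z1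
  rw [x0, z0, x1, z1]
  exact dia_poly_tip _ _ _ _ _ _ _ _ (by simp) (by simp) (w s(z, x)).2.1 (by linarith [(w s(z, x)).2.2]) (w s(x, t)).2.1
    (by linarith [(w s(x, t)).2.2]) (w s(y, t)).2.1 (by linarith [(w s(y, t)).2.2])
    (by rw [sub_nonneg]; exact one_le_inv_iff₀.2 ⟨hq0, hq1⟩) (sum_rcWeightW_ind_nonneg _ hq0.le _) (sum_rcWeightW_ind_nonneg _ hq0.le _)

/-- **EC⁺ at the tips of the diamond — base pair `zt`** (`0 < q ≤ 1`). [cite: Wagner2006, Ex. 5.1] [cite: Grimmett2006, §3.9 (pp. 63–64)] -/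
theorem edgeConnMono_diamond_base {q : ℝ} (hq0 : 0 < q) (hq1 : q ≤ 1) (w : Sym2 V → unitInterval) {z t x y : V}
    (hxz : x ≠ z) (hxt : x ≠ t) (hxy : x ≠ y) (hyz : y ≠ z) (hyt : y ≠ t) (hzt : z ≠ t)
    (hwx : ∀ e : Sym2 V, x ∈ e → ((w e : unitInterval) : ℝ) ≠ 0 → z ∈ e ∨ t ∈ e)
    (hwy : ∀ e : Sym2 V, y ∈ e → ((w e : unitInterval) : ℝ) ≠ 0 → z ∈ e ∨ t ∈ e) :
    (rcMeasureW (Function.update w s(z, t) 0) q ∅).real (openConn x y) ≤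
      (rcMeasureW (Function.update w s(z, t) 1) q ∅).real (openConn x y) := by
  rw [real_le_real_iff_mass hq0]
  have hxm : x ∉ s(z, t) := by rw [Sym2.mem_iff]; rintro (h | h); exacts [hxz h, hxt h]
  have hym : y ∉ s(z, t) := by rw [Sym2.mem_iff]; rintro (h | h); exacts [hyz h, hyt h]
  have ham : s(z, x) ≠ s(z, t) := fun h => hxm (h ▸ Sym2.mem_mk_right z x)
  have hbm : s(x, t) ≠ s(z, t) := fun h => hxm (h ▸ Sym2.mem_mk_left x t)
  have hcm : s(z, y) ≠ s(z, t) := fun h => hym (h ▸ Sym2.mem_mk_right z y)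
  have hdm : s(y, t) ≠ s(z, t) := fun h => hym (h ▸ Sym2.mem_mk_left y t)
  have hwx' : ∀ σ : unitInterval, ∀ e : Sym2 V, x ∈ e → ((Function.update w s(z, t) σ e : unitInterval) : ℝ) ≠ 0 → z ∈ e ∨ t ∈ e :=
    fun σ => apex_hyp_update hwx s(z, t) (fun h => absurd h hxm) σ
  have hwy' : ∀ σ : unitInterval, ∀ e : Sym2 V, y ∈ e → ((Function.update w s(z, t) σ e : unitInterval) : ℝ) ≠ 0 → z ∈ e ∨ t ∈ e :=
    fun σ => apex_hyp_update hwy s(z, t) (fun h => absurd h hym) σ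
  obtain ⟨x0, z0⟩ := dia_closed_forms (Function.update w s(z, t) 0) hq0.ne' hxz hxt hxy hyz hyt hzt (hwx' 0) (hwy' 0)
  obtain ⟨x1, z1⟩ := dia_closed_forms (Function.update w s(z, t) 1) hq0.ne' hxz hxt hxy hyz hyt hzt (hwx' 1) (hwy' 1)
  -- move the update of `zt` outside the four apex deletions
  have hcomm : ∀ σ : unitInterval,
      Function.update (Function.update (Function.update (Function.update (Function.update w s(z, t) σ) s(z, x) 0) s(x, t) 0) s(z, y) 0)
        s(y, t) 0 = Function.update (Function.update (Function.update (Function.update (Function.update w s(z, x) 0) s(x, t) 0) s(z, y) 0)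
          s(y, t) 0) s(z, t) σ := by
    intro σ
    rw [Function.update_comm ham.symm (f := w), Function.update_comm hbm.symm (f := Function.update w s(z, x) 0),
      Function.update_comm hcm.symm (f := Function.update (Function.update w s(z, x) 0) s(x, t) 0),
      Function.update_comm hdm.symm (f := Function.update (Function.update (Function.update w s(z, x) 0) s(x, t) 0) s(z, y) 0)]
  simp only [Function.update_of_ne ham, Function.update_of_ne hbm, Function.update_of_ne hcm, Function.update_of_ne hdm, hcomm]
    at x0 z0 x1 z1
  rw [x0, z0, x1, z1]
  have hB1 := base_compl_mass_eq_zero (Function.update (Function.update (Function.update (Function.update (Function.update w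
    s(z, x) 0) s(x, t) 0) s(z, y) 0) s(y, t) 0) s(z, t) 1) q hyz hyt hzt (by simp)
  exact dia_poly_base _ _ _ _ _ _ _ _ _ hB1 (w s(z, x)).2.1 (by linarith [(w s(z, x)).2.2]) (w s(x, t)).2.1
    (by linarith [(w s(x, t)).2.2]) (w s(z, y)).2.1 (by linarith [(w s(z, y)).2.2]) (w s(y, t)).2.1 (by linarith [(w s(y, t)).2.2])
    (by rw [sub_nonneg]; exact one_le_inv_iff₀.2 ⟨hq0, hq1⟩) (sum_rcWeightW_ind_nonneg _ hq0.le _) (sum_rcWeightW_ind_nonneg _ hq0.le _)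


/-- **Negative association on `K₄`, one pair fixed**: for `0 < q ≤ 1`, four distinct vertices `p, p', u, v`, a weight vector
supported on the pairs among them (no loops), the pair `pp'` is negatively associated with every other pair.  Reduction: by the
master identity to EC⁺ at the tips `p, p'` of the diamond `K₄ − pp'`, i.e. to the three certificates above.
[cite: Wagner2006, Ex. 5.1 (K₄: computation attributed to A. Sokal, 2005)] [cite: Grimmett2006, §3.9 eq. (3.94) (pp. 63–64)] -/
theorem negCorr_K4_pair {q : ℝ} (hq0 : 0 < q) (hq1 : q ≤ 1) (w : Sym2 V → unitInterval) {p p' u v : V} (hpp' : p ≠ p')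
    (hpu : p ≠ u) (hpv : p ≠ v) (hp'u : p' ≠ u) (hp'v : p' ≠ v) (huv : u ≠ v)
    (hV : ∀ e : Sym2 V, ((w e : unitInterval) : ℝ) ≠ 0 → ∀ a ∈ e, a = p ∨ a = p' ∨ a = u ∨ a = v)
    (hloop : ∀ a : V, ((w s(a, a) : unitInterval) : ℝ) = 0) (f : Sym2 V) (hfe : f ≠ s(p, p')) :
    (rcMeasureW w q ∅).real ({ω | s(p, p') ∈ ω} ∩ {ω | f ∈ ω}) ≤
      (rcMeasureW w q ∅).real {ω | s(p, p') ∈ ω} * (rcMeasureW w q ∅).real {ω | f ∈ ω} := by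
  by_cases hf0 : ((w f : unitInterval) : ℝ) = 0
  · exact negCorr_of_weight_zero_right hq0 w _ hf0
  -- the apex hypotheses at `p` and `p'` once `pp'` is closed
  set w' := Function.update w s(p, p') 0 with hw'def
  have hV' : ∀ e : Sym2 V, ((w' e : unitInterval) : ℝ) ≠ 0 → ∀ a ∈ e, a = p ∨ a = p' ∨ a = u ∨ a = v := by
    intro e he a ha
    by_cases hee : e = s(p, p')
    · subst hee; simp [hw'def] at he
    · rw [hw'def, Function.update_of_ne hee] at he
      exact hV e he a ha
  have hloop' : ∀ a : V, ((w' s(a, a) : unitInterval) : ℝ) = 0 := by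
    intro a
    have : s(a, a) ≠ s(p, p') := fun h => hpp' (by
      have hp : p ∈ s(a, a) := h ▸ Sym2.mem_mk_left p p'
      have hp' : p' ∈ s(a, a) := h ▸ Sym2.mem_mk_right p p'
      rw [Sym2.mem_iff, or_self] at hp hp'
      rw [hp, hp'])
    rw [hw'def, Function.update_of_ne this]; exact hloop a
  have apex : ∀ {c c' : V}, c ≠ c' → (c = p ∧ c' = p' ∨ c = p' ∧ c' = p) →
      ∀ e : Sym2 V, c ∈ e → ((w' e : unitInterval) : ℝ) ≠ 0 → u ∈ e ∨ v ∈ e := by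
    intro c c' hcc' hc e hce hne
    induction e using Sym2.ind with
    | h a b =>
      have hab : a ≠ b := by
        intro h; subst h; exact hne (hloop' a)
      have hepp : s(a, b) ≠ s(p, p') := by
        intro h; rw [hw'def, h] at hne; simp at hne
      have mem := hV' _ hne
      -- the other endpoint of `e` is `u` or `v`
      rw [Sym2.mem_iff] at hce
      have key : ∀ d : V, d ∈ s(a, b) → d ≠ c → d = u ∨ d = v ∨ d = c' := by
        intro d hd hdc
        rcases mem d hd with h | h | h | h
        · rcases hc with ⟨rfl, rfl⟩ | ⟨rfl, rfl⟩
          · exact absurd h hdc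
          · exact Or.inr (Or.inr h)
        · rcases hc with ⟨rfl, rfl⟩ | ⟨rfl, rfl⟩
          · exact Or.inr (Or.inr h)
          · exact absurd h hdc
        · exact Or.inl h
        · exact Or.inr (Or.inl h)
      rcases hce with rfl | rfl
      · rcases key b (Sym2.mem_mk_right c b) hab.symm with rfl | rfl | rfl
        · exact Or.inl (Sym2.mem_mk_right _ _)
        · exact Or.inr (Sym2.mem_mk_right _ _)
        · exfalso; apply hepp
          rcases hc with ⟨rfl, rfl⟩ | ⟨rfl, rfl⟩
          · rfl
          · exact Sym2.eq_swap
      · rcases key a (Sym2.mem_mk_left a c) hab with rfl | rfl | rfl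
        · exact Or.inl (Sym2.mem_mk_left _ _)
        · exact Or.inr (Sym2.mem_mk_left _ _)
        · exfalso; apply hepp
          rcases hc with ⟨rfl, rfl⟩ | ⟨rfl, rfl⟩
          · exact Sym2.eq_swap
          · rfl
  have hwp : ∀ e : Sym2 V, p ∈ e → ((w' e : unitInterval) : ℝ) ≠ 0 → u ∈ e ∨ v ∈ e := apex hpp' (Or.inl ⟨rfl, rfl⟩)
  have hwp' : ∀ e : Sym2 V, p' ∈ e → ((w' e : unitInterval) : ℝ) ≠ 0 → u ∈ e ∨ v ∈ e := apex hpp'.symm (Or.inr ⟨rfl, rfl⟩)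
  refine negCorr_of_edgeConnMono_at hq0 hq1 w hfe ?_
  rw [← hw'def]
  -- where is `f`?
  induction f using Sym2.ind with
  | h a b =>
    have hab : a ≠ b := by intro h; subst h; exact hf0 (hloop a)
    have ha := hV _ hf0 a (Sym2.mem_mk_left a b)
    have hb := hV _ hf0 b (Sym2.mem_mk_right a b)
    have SIDE := edgeConnMono_diamond_side hq0 hq1 w' hpu hpv hpp' hp'u hp'v huv hwp hwp'
    have SIDE' := edgeConnMono_diamond_side hq0 hq1 w' hpv hpu hpp' hp'v hp'u huv.symm (apex_hyp_swap hwp) (apex_hyp_swap hwp')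
    have TIP := edgeConnMono_diamond_tip hq0 hq1 w' hpu hpv hpp' hp'u hp'v huv hwp hwp'
    have TIP' := edgeConnMono_diamond_tip hq0 hq1 w' hpv hpu hpp' hp'v hp'u huv.symm (apex_hyp_swap hwp) (apex_hyp_swap hwp')
    have BASE := edgeConnMono_diamond_base hq0 hq1 w' hpu hpv hpp' hp'u hp'v huv hwp hwp'
    rcases ha with ha | ha | ha | ha <;> rcases hb with hb | hb | hb | hb <;> rw [ha, hb] at hfe hab ⊢
    · exact absurd rfl hab
    · exact absurd rfl hfe
    · rw [Sym2.eq_swap]; exact SIDE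
    · rw [Sym2.eq_swap]; exact SIDE'
    · exact absurd Sym2.eq_swap hfe
    · exact absurd rfl hab
    · rw [Sym2.eq_swap]; exact TIP
    · rw [Sym2.eq_swap]; exact TIP'
    · exact SIDE
    · exact TIP
    · exact absurd rfl hab
    · exact BASE
    · exact SIDE'
    · exact TIP'
    · rw [Sym2.eq_swap]; exact BASE
    · exact absurd rfl hab

/-- **Negative association of `φ_{w,q}`, `0 < q ≤ 1`, on `K₄` — kernel certificate of the computation Wagner attributes to A. Sokal
(2005, unpublished).**  For four distinct vertices `x, y, z, t` of any finite vertex type and every weight vector supported on the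
six pairs among them (no loops): `φ(J_e ∩ J_f) ≤ φ(J_e)·φ(J_f)` for all non-loop `e` and `f ≠ e`.  `K₄` is the excluded minor of the
series–parallel class, so this is the first case beyond `edgeNegCorrSupp_of_isTwoTree`; with the apex step `edgeNegCorr_supp_apex_step`
it propagates to every 2-tree grown on a `K₄`. [cite: Wagner2006, Ex. 5.1] [cite: Grimmett2006, §3.9 eq. (3.94), Conj. (3.96) (pp. 63–64)] -/
theorem edgeNegCorr_K4 {q : ℝ} (hq0 : 0 < q) (hq1 : q ≤ 1) (w : Sym2 V → unitInterval) {x y z t : V} (hxy : x ≠ y) (hxz : x ≠ z)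
    (hxt : x ≠ t) (hyz : y ≠ z) (hyt : y ≠ t) (hzt : z ≠ t)
    (hV : ∀ e : Sym2 V, ((w e : unitInterval) : ℝ) ≠ 0 → ∀ a ∈ e, a = x ∨ a = y ∨ a = z ∨ a = t)
    (hloop : ∀ a : V, ((w s(a, a) : unitInterval) : ℝ) = 0) :
    ∀ e f : Sym2 V, ¬ e.IsDiag → f ≠ e →
      (rcMeasureW w q ∅).real ({ω | e ∈ ω} ∩ {ω | f ∈ ω}) ≤
        (rcMeasureW w q ∅).real {ω | e ∈ ω} * (rcMeasureW w q ∅).real {ω | f ∈ ω} := by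
  intro e f _ hfe
  by_cases he0 : ((w e : unitInterval) : ℝ) = 0
  · exact negCorr_of_weight_zero_left hq0 w f he0
  have hV' : ∀ (p p' u v : V), (∀ a : V, (a = x ∨ a = y ∨ a = z ∨ a = t) → (a = p ∨ a = p' ∨ a = u ∨ a = v)) →
      ∀ e : Sym2 V, ((w e : unitInterval) : ℝ) ≠ 0 → ∀ a ∈ e, a = p ∨ a = p' ∨ a = u ∨ a = v :=
    fun p p' u v h e he a ha => h a (hV e he a ha)
  induction e using Sym2.ind with
  | h a b =>
    have hab : a ≠ b := by intro h; subst h; exact he0 (hloop a)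
    have ha := hV _ he0 a (Sym2.mem_mk_left a b)
    have hb := hV _ he0 b (Sym2.mem_mk_right a b)
    rcases ha with ha | ha | ha | ha <;> rcases hb with hb | hb | hb | hb <;> rw [ha, hb] at hfe hab ⊢
    · exact absurd rfl hab
    · exact negCorr_K4_pair hq0 hq1 w hxy hxz hxt hyz hyt hzt (hV' x y z t fun a h => by tauto) hloop f hfe
    · exact negCorr_K4_pair hq0 hq1 w hxz hxy hxt hyz.symm hzt hyt (hV' x z y t fun a h => by tauto) hloop f hfe
    · exact negCorr_K4_pair hq0 hq1 w hxt hxy hxz hyt.symm hzt.symm hyz (hV' x t y z fun a h => by tauto) hloop f hfe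
    · exact negCorr_K4_pair hq0 hq1 w hxy.symm hyz hyt hxz hxt hzt (hV' y x z t fun a h => by tauto) hloop f hfe
    · exact absurd rfl hab
    · exact negCorr_K4_pair hq0 hq1 w hyz hxy.symm hyt hxz.symm hzt hxt (hV' y z x t fun a h => by tauto) hloop f hfe
    · exact negCorr_K4_pair hq0 hq1 w hyt hxy.symm hyz hxt.symm hzt.symm hxz (hV' y t x z fun a h => by tauto) hloop f hfe
    · exact negCorr_K4_pair hq0 hq1 w hxz.symm hyz.symm hzt hxy hxt hyt (hV' z x y t fun a h => by tauto) hloop f hfe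
    · exact negCorr_K4_pair hq0 hq1 w hyz.symm hxz.symm hzt hxy.symm hyt hxt (hV' z y x t fun a h => by tauto) hloop f hfe
    · exact absurd rfl hab
    · exact negCorr_K4_pair hq0 hq1 w hzt hxz.symm hyz.symm hxt.symm hyt.symm hxy (hV' z t x y fun a h => by tauto) hloop f hfe
    · exact negCorr_K4_pair hq0 hq1 w hxt.symm hyt.symm hzt.symm hxy hxz hyz (hV' t x y z fun a h => by tauto) hloop f hfe
    · exact negCorr_K4_pair hq0 hq1 w hyt.symm hxt.symm hzt.symm hxy.symm hyz hxz (hV' t y x z fun a h => by tauto) hloop f hfe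
    · exact negCorr_K4_pair hq0 hq1 w hzt.symm hxt.symm hyt.symm hxz.symm hyz.symm hxy
        (hV' t z x y fun a h => by tauto) hloop f hfe
    · exact absurd rfl hab

/-- **Negative association on `K₄`, support form**: for `0 < q ≤ 1` and every weight vector supported in the six pairs of four
distinct vertices `x, y, z, t`, every two distinct pairs are negatively associated — the hypothesis shape of
`edgeNegCorr_supp_apex_step`, so negative association propagates to every edge set grown from this `K₄` by apex steps.
[cite: Wagner2006, Ex. 5.1] [cite: Grimmett2006, §3.9 eq. (3.94) (pp. 63–64)] -/
theorem edgeNegCorr_supp_K4 {q : ℝ} (hq0 : 0 < q) (hq1 : q ≤ 1) {x y z t : V} (hxy : x ≠ y) (hxz : x ≠ z) (hxt : x ≠ t)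
    (hyz : y ≠ z) (hyt : y ≠ t) (hzt : z ≠ t) :
    ∀ w : Sym2 V → unitInterval,
      (∀ e, ((w e : unitInterval) : ℝ) ≠ 0 → e ∈ ({s(x, y), s(x, z), s(x, t), s(y, z), s(y, t), s(z, t)} : Set (Sym2 V))) →
      ∀ e f : Sym2 V, ¬ e.IsDiag → f ≠ e →
        (rcMeasureW w q ∅).real ({ω | e ∈ ω} ∩ {ω | f ∈ ω}) ≤
          (rcMeasureW w q ∅).real {ω | e ∈ ω} * (rcMeasureW w q ∅).real {ω | f ∈ ω} := by
  intro w hw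
  have hV : ∀ e : Sym2 V, ((w e : unitInterval) : ℝ) ≠ 0 → ∀ a ∈ e, a = x ∨ a = y ∨ a = z ∨ a = t := by
    intro e he a ha
    have hmem := hw e he
    simp only [Set.mem_insert_iff, Set.mem_singleton_iff] at hmem
    rcases hmem with rfl | rfl | rfl | rfl | rfl | rfl <;> (rw [Sym2.mem_iff] at ha; rcases ha with rfl | rfl <;> simp)
  have hloop : ∀ a : V, ((w s(a, a) : unitInterval) : ℝ) = 0 := by
    intro a
    by_contra h
    have hmem := hw _ h
    simp only [Set.mem_insert_iff, Set.mem_singleton_iff] at hmem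
    have hdiag : (s(a, a) : Sym2 V).IsDiag := rfl
    rcases hmem with h' | h' | h' | h' | h' | h' <;> (rw [h', Sym2.mk_isDiag_iff] at hdiag)
    exacts [hxy hdiag, hxz hdiag, hxt hdiag, hyz hdiag, hyt hdiag, hzt hdiag]
  exact edgeNegCorr_K4 hq0 hq1 w hxy hxz hxt hyz hyt hzt hV hloop

/-- **Pairwise positive correlation of connection events on `K₄`, every `q ∈ (0,1)`, all weights** — via fk-2's reduction from
negative edge association. [cite: AyyerLinussonRavichandran2025, §7 eq. (13)–(15) (p. 22)] [cite: Wagner2006, Ex. 5.1] -/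
theorem pairConnPosUnder_K4 {q : ℝ} (hq0 : 0 < q) (hq1 : q < 1) {x y z t : V} (hxy : x ≠ y) (hxz : x ≠ z) (hxt : x ≠ t)
    (hyz : y ≠ z) (hyt : y ≠ t) (hzt : z ≠ t) {a b c d : V}
    (hab : s(a, b) ∈ ({s(x, y), s(x, z), s(x, t), s(y, z), s(y, t), s(z, t)} : Set (Sym2 V)))
    (hcd : s(c, d) ∈ ({s(x, y), s(x, z), s(x, t), s(y, z), s(y, t), s(z, t)} : Set (Sym2 V))) (w : Sym2 V → unitInterval)
    (hw : ∀ e, ((w e : unitInterval) : ℝ) ≠ 0 → e ∈ ({s(x, y), s(x, z), s(x, t), s(y, z), s(y, t), s(z, t)} : Set (Sym2 V))) :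
    PairConnPosUnder (rcMeasureW w q ∅) a b c d :=
  pairConnPosUnder_of_edgeNegCorr_on hq0 hq1 _ (edgeNegCorr_supp_K4 hq0 hq1.le hxy hxz hxt hyz hyt hzt) a b c d hab hcd w hw

/-- **The hub inequality (ALR 2025, (13)) on `K₄`, every `q ∈ (0,1)`, all weights**: `φ(o ↔ a)φ(b ↔ a) ≤ φ(o ↔ a ↔ b)` for any
three of the four vertices. [cite: AyyerLinussonRavichandran2025, §7 eq. (13), Conj. 7.1 (p. 22)] [cite: Wagner2006, Ex. 5.1] -/
theorem hubUnder_K4 {q : ℝ} (hq0 : 0 < q) (hq1 : q < 1) {x y z t : V} (hxy : x ≠ y) (hxz : x ≠ z) (hxt : x ≠ t)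
    (hyz : y ≠ z) (hyt : y ≠ t) (hzt : z ≠ t) (w : Sym2 V → unitInterval)
    (hw : ∀ e, ((w e : unitInterval) : ℝ) ≠ 0 → e ∈ ({s(x, y), s(x, z), s(x, t), s(y, z), s(y, t), s(z, t)} : Set (Sym2 V))) :
    HubUnder (rcMeasureW w q ∅) x y z :=
  hubUnder_of_edgeNegCorr_on hq0 hq1 _ (edgeNegCorr_supp_K4 hq0 hq1.le hxy hxz hxt hyz hyt hzt) x y z (by simp)
    (by simp [Sym2.eq_swap]) w hw

end FK

end Summit.CriticalPhenomena.PercolationContinuityZ3.Theorems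

end
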